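import Literature.AlgebraicGeometry.Motives.MixedHodgeStructureDualKerCoker
import Literature.AlgebraicGeometry.Motives.MixedHodgeStructureSubobjects
import HarnessLib

/-!
# Duality for sub- and quotient mixed Hodge structures; Tate twists under duality

For a mixed `ℚ`-Hodge structure `H` on a finite-dimensional `V`, its dual `H^∨`
(`MixedHodgeStructure.dual`; Fujiki 1980 (1.6.2), Cattani–El Zein–Griffiths–Lê §3.2.2.7) and a sub-MHS
`S ⊆ H` (`SubMixedHodgeStructure`; the sub-objects of the abelian category of MHS, Deligne *Hodge II*
Thm. 2.3.5, Cattani et al. Lemma 3.2.20):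

* **the annihilator `S^⊥ ⊆ H^∨` is a sub-MHS** (`SubMixedHodgeStructure.annihilator`: the kernel of
  the restriction morphism `H^∨ → S^∨`, transpose of `S ↪ H`; also the image of `(H/S)^∨ → H^∨`,
  `range_mkQ_transpose_eq_annihilator`) — Fujiki (1.6.2) b): "Let `E` be any mixed `ℚ`-Hodge
  substructure of `H₁` and `E'` the orthogonal complement of `E` in `H₂` … Then `E'` is a mixed
  `ℚ`-Hodge substructure of `H₂` and the induced pairing `E × H₂/E' → ℚ` gives a duality";
* `U ↦ U^⊥` reverses inclusions and exchanges `∩` and `+` of sub-MHS, `(W_k H)^⊥ = W_{-k-1}(H^∨)`;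
* **`(H/S)^∨ ≅ S^⊥`** (`quotientDualHom`, bijective) and **`S^∨ ≅ H^∨/S^⊥`** (`dualQuotientHom`,
  bijective) as mixed Hodge structures, whence
  `h^{p,q}(S^⊥) = h^{-p,-q}(H/S)` and `h^{p,q}(H^∨/S^⊥) = h^{-p,-q}(S)`;
* **`(H(j))^∨ = H^∨(-j)`** for the Tate twist (`dual_tateTwist`; Cattani et al. Ex. 3.2.23 (4):
  `W_r H(m) = W_{r+2m} H`, `F^p H(m) = F^{p+m} H`).

Everything is proved; no named facts.

## References

* [Fujiki1980] A. Fujiki, Duality of mixed Hodge structures of algebraic varieties, Publ. RIMS 16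
  (1980), (1.6.2) a)–b) (p. 640).
* [CattaniElZeinGriffithsLe2014] E. Cattani et al. (eds.), *Hodge Theory* (2014), Lemma 3.2.20,
  §3.2.2.7, Ex. 3.2.23 (4).
* [DeligneHodgeII1971] P. Deligne, Théorie de Hodge II, 1.1.6–1.1.7, Thm. 2.3.5.
-/

noncomputable section

namespace Literature.AlgebraicGeometry.Motives

namespace MixedHodgeStructure

universe u

variable {V : Type u} [AddCommGroup V] [Module ℚ V] [FiniteDimensional ℚ V]

open Module

/-! ### Tate twists under duality -/

/-- **`(H(j))^∨ = H^∨(-j)`**: `W_r(H(j)^∨) = (W_{-r-1+2j} H)^⊥ = W_{r-2j}(H^∨)` and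
`F^p(H(j)^∨) = (F^{1-p+j} H)^⊥ = F^{p-j}(H^∨)`. [cite: CattaniElZeinGriffithsLe2014, Ex. 3.2.23 (4) and §3.2.2.7] -/
theorem dual_tateTwist (H : MixedHodgeStructure V) (j : ℤ) :
    (H.tateTwist j).dual = H.dual.tateTwist (-j) := by
  refine ext_of_W_F (funext fun r => ?_) (funext fun p => ?_)
  · rw [dual_W, tateTwist_W, tateTwist_W, dual_W, show -r - 1 + 2 * j = -(r + 2 * -j) - 1 by ring]
  · rw [dual_F, tateTwist_F, tateTwist_F, dual_F, show 1 - p + j = 1 - (p + -j) by ring]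

namespace SubMixedHodgeStructure

variable {H : MixedHodgeStructure V}

/-! ### The annihilator of a sub-MHS -/

omit [FiniteDimensional ℚ V] in
/-- `(H → H/S) ∘ (S ↪ H) = 0`. [cite: CattaniElZeinGriffithsLe2014, Lemma 3.2.20] -/
theorem mkQ_comp_subtype (S : SubMixedHodgeStructure H) :
    S.mkQ.comp S.subtype = Hom.zero S.toMixedHodgeStructure S.quotient :=
  Hom.ext (LinearMap.ext fun x => (Submodule.Quotient.mk_eq_zero _).2 x.2)

/-- **The annihilator `S^⊥ ⊆ H^∨` of a sub-MHS is a sub-MHS**: it is the kernel of the restriction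
morphism `H^∨ → S^∨` (the transpose of `S ↪ H`). Fujiki (1.6.2) b): the orthogonal complement of a
mixed Hodge substructure is a mixed Hodge substructure. [cite: Fujiki1980, (1.6.2) b)] -/
def annihilator (S : SubMixedHodgeStructure H) : SubMixedHodgeStructure H.dual :=
  S.subtype.transpose.ker

/-- The underlying subspace of `S.annihilator` is `S^⊥ = {φ | φ(S) = 0}`. [cite: Fujiki1980, (1.6.2) b)] -/
@[simp]
theorem annihilator_toSubmodule (S : SubMixedHodgeStructure H) :
    S.annihilator.toSubmodule = S.toSubmodule.dualAnnihilator := by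
  rw [annihilator, Hom.ker_transpose_toSubmodule]
  exact congrArg Submodule.dualAnnihilator S.toSubmodule.range_subtype

/-- `S^⊥` is also the image of `(H/S)^∨ ↪ H^∨` (forms on `H/S` = forms on `H` killing `S`).
[cite: Fujiki1980, (1.6.2) b)] -/
theorem range_mkQ_transpose_eq_annihilator (S : SubMixedHodgeStructure H) :
    S.mkQ.transpose.range = S.annihilator := by
  refine ext ?_
  rw [Hom.range_toSubmodule, Hom.transpose_toLinearMap, annihilator_toSubmodule]
  exact Submodule.range_dualMap_mkQ_eq _

/-- `U ↦ U^⊥` reverses inclusions of sub-MHS. [cite: Fujiki1980, (1.6.2) b)] -/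
theorem annihilator_le_annihilator_iff (S T : SubMixedHodgeStructure H) :
    S.annihilator.toSubmodule ≤ T.annihilator.toSubmodule ↔ T.toSubmodule ≤ S.toSubmodule := by
  rw [annihilator_toSubmodule, annihilator_toSubmodule, Subspace.dualAnnihilator_le_dualAnnihilator_iff]

/-- `H^⊥ = 0`. [cite: Fujiki1980, (1.6.2) b)] -/
theorem annihilator_top : (top H).annihilator = bot H.dual :=
  ext (by rw [annihilator_toSubmodule, top_toSubmodule, bot_toSubmodule, Submodule.dualAnnihilator_top])

/-- `0^⊥ = H^∨`. [cite: Fujiki1980, (1.6.2) b)] -/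
theorem annihilator_bot : (bot H).annihilator = top H.dual :=
  ext (by rw [annihilator_toSubmodule, top_toSubmodule, bot_toSubmodule, Submodule.dualAnnihilator_bot])

/-- `(S + T)^⊥ = S^⊥ ∩ T^⊥`. [cite: Fujiki1980, (1.6.2) b)] -/
theorem annihilator_sup (S T : SubMixedHodgeStructure H) :
    (S.sup T).annihilator = S.annihilator.inf T.annihilator :=
  ext (by rw [annihilator_toSubmodule, sup_toSubmodule, inf_toSubmodule, annihilator_toSubmodule,
    annihilator_toSubmodule, Submodule.dualAnnihilator_sup_eq])

/-- `(S ∩ T)^⊥ = S^⊥ + T^⊥`. [cite: Fujiki1980, (1.6.2) b)] -/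
theorem annihilator_inf (S T : SubMixedHodgeStructure H) :
    (S.inf T).annihilator = S.annihilator.sup T.annihilator :=
  ext (by rw [annihilator_toSubmodule, inf_toSubmodule, sup_toSubmodule, annihilator_toSubmodule,
    annihilator_toSubmodule, Subspace.dualAnnihilator_inf_eq])

/-- **`(W_k H)^⊥ = W_{-k-1}(H^∨)`** as sub-MHS of `H^∨` (the definition of the dual weight filtration,
Fujiki (1.6.2) a): `W'_i = (W_{-i-1})^⊥`). [cite: Fujiki1980, (1.6.2) a)] -/
theorem annihilator_weight (H : MixedHodgeStructure V) (k : ℤ) :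
    (weight H k).annihilator = weight H.dual (-k - 1) :=
  ext (by rw [annihilator_toSubmodule, weight_toSubmodule, weight_toSubmodule, dual_W,
    show -(-k - 1) - 1 = k by ring])

/-! ### `(H/S)^∨ ≅ S^⊥` and `S^∨ ≅ H^∨/S^⊥` -/

/-- `(S ↪ H)^∨ ∘ (H ↠ H/S)^∨ = ((H ↠ H/S) ∘ (S ↪ H))^∨ = 0`. [cite: Fujiki1980, (1.6.2) b)] -/
theorem subtype_transpose_comp_mkQ_transpose (S : SubMixedHodgeStructure H) :
    S.subtype.transpose.comp S.mkQ.transpose = Hom.zero S.quotient.dual S.toMixedHodgeStructure.dual := by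
  rw [← Hom.transpose_comp, mkQ_comp_subtype, Hom.transpose_zero]

/-- **The canonical morphism `(H/S)^∨ → S^⊥`** (`φ ↦ φ ∘ (H ↠ H/S)`, through the universal property of
the kernel `S^⊥ = Ker(H^∨ → S^∨)`). [cite: Fujiki1980, (1.6.2) b)] -/
def quotientDualHom (S : SubMixedHodgeStructure H) : Hom S.quotient.dual S.annihilator.toMixedHodgeStructure :=
  S.subtype.transpose.kerLift S.mkQ.transpose S.subtype_transpose_comp_mkQ_transpose

/-- `(S^⊥ ↪ H^∨) ∘ quotientDualHom = (H ↠ H/S)^∨`. [cite: Fujiki1980, (1.6.2) b)] -/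
theorem annihilator_subtype_comp_quotientDualHom (S : SubMixedHodgeStructure H) :
    S.annihilator.subtype.comp S.quotientDualHom = S.mkQ.transpose :=
  Hom.ker_subtype_comp_kerLift _ _ _

/-- **`(H/S)^∨ ≅ S^⊥` as mixed Hodge structures**: `quotientDualHom` is bijective (injective as
`(H ↠ H/S)^∨` is; onto because `S^⊥ = Im((H ↠ H/S)^∨)`). Fujiki (1.6.2) b): "the induced pairing
`E × H₂/E' → ℚ` gives a duality of mixed `ℚ`-Hodge structures". [cite: Fujiki1980, (1.6.2) b)] -/
theorem quotientDualHom_bijective (S : SubMixedHodgeStructure H) :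
    Function.Bijective S.quotientDualHom.toLinearMap := by
  constructor
  · have h : Function.Injective (S.annihilator.subtype.comp S.quotientDualHom).toLinearMap := by
      rw [annihilator_subtype_comp_quotientDualHom, Hom.transpose_toLinearMap]
      exact LinearMap.dualMap_injective_of_surjective (Submodule.mkQ_surjective _)
    rw [Hom.comp_toLinearMap, LinearMap.coe_comp] at h
    exact Function.Injective.of_comp h
  · rintro ⟨ψ, hψ⟩
    have hψ' : ψ ∈ S.mkQ.transpose.range.toSubmodule := by
      rw [range_mkQ_transpose_eq_annihilator]
      exact hψ
    obtain ⟨φ, rfl⟩ := hψ'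
    exact ⟨φ, Subtype.ext (congrArg (fun g : Hom S.quotient.dual H.dual => g.toLinearMap φ)
      S.annihilator_subtype_comp_quotientDualHom)⟩

/-- **The canonical morphism `H^∨/S^⊥ → S^∨`** (restriction of forms, through the universal property
of the quotient by `S^⊥ = Ker(H^∨ → S^∨)`). [cite: Fujiki1980, (1.6.2) b)] -/
def dualQuotientHom (S : SubMixedHodgeStructure H) : Hom S.annihilator.quotient S.toMixedHodgeStructure.dual :=
  S.annihilator.quotientLift S.subtype.transpose (by rw [annihilator, Hom.ker_toSubmodule])

/-- `dualQuotientHom [φ] = φ|_S`. [cite: Fujiki1980, (1.6.2) b)] -/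
@[simp]
theorem dualQuotientHom_apply_mk (S : SubMixedHodgeStructure H) (φ : Module.Dual ℚ V) :
    S.dualQuotientHom.toLinearMap (Submodule.Quotient.mk φ) = φ ∘ₗ S.toSubmodule.subtype := rfl

/-- **`H^∨/S^⊥ ≅ S^∨` as mixed Hodge structures**: `dualQuotientHom` is bijective (onto as restriction
`H^∨ → S^∨` is; injective because its kernel is exactly `S^⊥`). [cite: Fujiki1980, (1.6.2) b)] -/
theorem dualQuotientHom_bijective (S : SubMixedHodgeStructure H) :
    Function.Bijective S.dualQuotientHom.toLinearMap := by
  constructor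
  · rw [← LinearMap.ker_eq_bot, eq_bot_iff]
    intro x hx
    induction x using Submodule.Quotient.induction_on with
    | _ φ =>
      rw [LinearMap.mem_ker, dualQuotientHom_apply_mk] at hx
      rw [Submodule.mem_bot, Submodule.Quotient.mk_eq_zero, annihilator_toSubmodule,
        Submodule.mem_dualAnnihilator]
      intro w hw
      exact LinearMap.congr_fun hx ⟨w, hw⟩
  · have h : Function.Surjective (S.dualQuotientHom.comp S.annihilator.mkQ).toLinearMap := by
      rw [dualQuotientHom, quotientLift_comp_mkQ, Hom.transpose_toLinearMap]
      exact LinearMap.dualMap_surjective_of_injective Subtype.val_injective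
    rw [Hom.comp_toLinearMap, LinearMap.coe_comp] at h
    exact Function.Surjective.of_comp h

/-! ### Hodge numbers -/

/-- **`h^{p,q}(S^⊥) = h^{-p,-q}(H/S)`.** [cite: Fujiki1980, (1.6.2) b)] -/
theorem hodgeNumber_annihilator (S : SubMixedHodgeStructure H) (p q : ℤ) :
    S.annihilator.toMixedHodgeStructure.hodgeNumber p q = S.quotient.hodgeNumber (-p) (-q) := by
  rw [← S.quotientDualHom.hodgeNumber_eq_of_bijective S.quotientDualHom_bijective, hodgeNumber_dual]

/-- **`h^{p,q}(H^∨/S^⊥) = h^{-p,-q}(S)`.** [cite: Fujiki1980, (1.6.2) b)] -/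
theorem hodgeNumber_annihilator_quotient (S : SubMixedHodgeStructure H) (p q : ℤ) :
    S.annihilator.quotient.hodgeNumber p q = S.toMixedHodgeStructure.hodgeNumber (-p) (-q) := by
  rw [S.dualQuotientHom.hodgeNumber_eq_of_bijective S.dualQuotientHom_bijective, hodgeNumber_dual]

end SubMixedHodgeStructure

end MixedHodgeStructure

end Literature.AlgebraicGeometry.Motives

end
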